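import Mathlib
import HarnessLib
import Summits.HubbardSuperconductivity.HubbardSuperconductivity.Theorems.KLProgrammeC4aZoneAssembly
import Summits.HubbardSuperconductivity.HubbardSuperconductivity.Theorems.KLProgrammeC4aChordMidpointDepth
import Summits.HubbardSuperconductivity.HubbardSuperconductivity.Theorems.KLProgrammeC4aAbsBubbleNonCooper

/-!
# Route `KLProgramme` — crux C4a, S3 brick (B4) «(U1)-ZONE-ASSEMBLY» part 5: THE GENERIC ARC — the zone theorem with its two model-geometric pointwise rows DISCHARGED:
# the loop curvature ceiling (`G₂ := K₂msD₁² + K₁msD₂`, `…C4aAbsBubbleNonCooper`) and the direct-sheet exclusion (no `m = 0` caustic) from the CHORD-MIDPOINT DEPTH of the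
# Fermi sea (`…C4aChordMidpointDepth` §4) on every arc `‖ϑ‖_𝕋 ≳ √(A + |ρ| + K_c τ₀)`

Cell `gate-hubbard-kl`, seat hubbard-kl-k3c3-p3 (g34; row «implicit-function / monotonicity route for μ(n)»).  Located brick for the (C)-closer lane / the (M4)
assembly of the umklapp first-order ϑ-layer (stub (C) `stub_twoLeg_curvature` of `KLRegimeEngineV17F2`, stmt-HubbardSuperconductivity-20437), memo
HOME/hubbard-kl-k3c3-p3/U1-CAUSTIC-SUP.md §16.

WHY.  `…C4aZoneAssembly.zone_integral_le` keeps three `ϑ`-pointwise rows on the zone: `hC` (not Cooper for any sheet — the closer's, from `…C4aPathComparability.norm_pairSumPath_zero_ge`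
for `m = 0` and the path range `…C4aPathRange` / `KlwjCertB` for `m ≠ 0`), `hcurv` and `hT0`.  The last two are model geometry and are discharged here once and for all:
* `hcurv`: `|∂ᵥ² e_K(S(ϑ) − Φ(e, v+θ))| ≤ K₂·msD₁² + K₁·msD₂` at every `|e| ≤ hi < r` (`abs_iteratedDeriv_two_partnerBand_pp_angle_le`);
* `hT0`: if `‖S(ϑ) − 2Φ(0,χ)‖ ≤ τ₀` for some loop angle `χ`, then the chord `Φ(0,θ) − Φ(ρ,ϑ+θ)` is short (`norm_chord_sq_le_of_midpoint_near`: `‖chord‖² ≤ 6π²(2A + |ρ| + K_cτ₀/2)/(−μ−A−|ρ|)`,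
  the frame's level-convexity with its `2A + |ρ|` slack) and the chord controls the relative angle (`torusDist_le_norm_chord`: `(2u_min/π)‖ϑ‖_𝕋 ≤ ‖chord‖`); so on the ARC
  `harc : 6π²(2A + |ρ| + K_cτ₀/2)/(−μ−A−|ρ|) < ((2u_min/π)‖ϑ‖_𝕋)²` there is no direct-sheet caustic at scale `τ₀` — the tangency neighbourhood excluded is `√(A + |ρ| + K_cτ₀)`-wide
  (`n`-free; it is the (T) region of B4-TAN-FOLD / DIRECT-PACK, not a threshold).
* **`arc_integral_le`** (HEADLINE): `zone_integral_le` with `hcurv` removed (`G₂` written out in `b_mono`) and `hT0` replaced by `harc`.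
Sizes binder shape + `FrameOK`/`GeomConstants`; nothing asserts (C), K3 or superconductivity.
References: FST II CPAM 51 (1998) §3 (H3) [cite: FeldmanSalmhoferTrubowitz1998]; BGM 2003 §7.1 [cite: BenfattoGiulianiMastropietro2003]; BGM 2006 §2.4 [cite: BenfattoGiulianiMastropietro2006].
-/


noncomputable section

namespace Summit.HubbardSuperconductivity.HubbardSuperconductivity.Theorems.C4a

set_option linter.dupNamespace false -- summit = problem name (single-conjunct summit), D-0017

open Real Set MeasureTheory intervalIntegral
open Literature.MathematicalPhysics.QuantumLattice Literature.MathematicalPhysics.QuantumLattice.BandSectorCounting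
open Literature.MathematicalPhysics.QuantumLattice.FermiRG
open Summit.HubbardSuperconductivity.HubbardSuperconductivity.Theorems.KLRegimeSplit
open Summit.HubbardSuperconductivity.HubbardSuperconductivity.Theorems.DispersionFlow
open Summit.HubbardSuperconductivity.HubbardSuperconductivity.Theorems.PerturbedFermiCurve

section Sizes

variable {K : TrigPolyC4v} {A : ℝ} (hA : ∀ p : Momentum, ∀ j ≤ 2, ‖iteratedFDeriv ℝ j (frameShift K) p‖ ≤ A) (hA20 : A ≤ 1 / 20)
  (hd : klCurveD ≤ (bandBounds (show (-4 : ℝ) < -1.1 by norm_num) (show (-1.1 : ℝ) ≤ -0.1 by norm_num)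
    (show (-0.1 : ℝ) < 0 by norm_num)).Dtmin - 2 * A)
  {μ r : ℝ} (hr : 0 < r) (hlo : (-1.1 : ℝ) < μ - r - A) (hhi : μ + r + A < -0.1)
  {A₃ A₄ : ℝ} (hA₃ : ∀ p : Momentum, ‖iteratedFDeriv ℝ 3 (frameShift K) p‖ ≤ A₃)
  (hA₄ : ∀ p : Momentum, ‖iteratedFDeriv ℝ 4 (frameShift K) p‖ ≤ A₄)
  {K₁ K₂ K₃ : ℝ} (hK₁ : ∀ p : Momentum, ‖fderiv ℝ (frameLevel μ K) p‖ ≤ K₁) (hK₂ : ∀ p : Momentum, ‖iteratedFDeriv ℝ 2 (frameLevel μ K) p‖ ≤ K₂)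
  (hK₃ : ∀ p : Momentum, ‖iteratedFDeriv ℝ 3 (frameLevel μ K) p‖ ≤ K₃)
include hA hA20 hd hr hlo hhi hA₃ hA₄ hK₁ hK₂ hK₃

set_option maxHeartbeats 400000 in
/-- **THE GENERIC ARC OF THE UMKLAPP FIRST-ORDER ϑ-LAYER** (HEADLINE; see the module docstring): the zone theorem on `[α₀, α₀ + Nℓ]` with the curvature ceiling and
the direct-sheet exclusion discharged from the frame geometry; the arc row `harc` says the zone stays `≳ √(A + |ρ| + K_cτ₀)` away from the tangency configuration. -/
theorem arc_integral_le {R : RenConsts} {U : ℝ} {N : ℕ} (hF : FrameOK R U N μ K) {Kc r₀ g₀ w : ℝ} (hG : GeomConstants (frameLevel μ K) Kc r₀ g₀ w)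
    {ρ : ℝ} (hρ : |ρ| < r) (hρ₀ : |ρ| < 3 / 80) (θ : ℝ) {Nt : ℕ}
    {α₀ ℓ φa φb τ₀ lo hi Wφ Wm qs Δ K₀ X₀ X₁ XL W Afl Bfl Dfl Mρ Γ Γ' η₀ Δc ω d₁ lam eps : ℝ} {Kr X : ℝ → ℝ → ℝ} {wt ρm : ℝ → ℝ}
    (hℓ : 0 ≤ ℓ) (hφ : φa ≤ φb) (hWm : 0 ≤ Wm) (hMρ : 0 ≤ Mρ)
    (hWφ : φb - φa + 2 * Wm ≤ Wφ)
    (hmod : K₃ * (τ₀ + msD A₃ A₄ 1 * (ℓ) +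
              hi / ((bandBounds (show (-4 : ℝ) < -1.1 by norm_num) (show (-1.1 : ℝ) ≤ -0.1 by norm_num) (show (-0.1 : ℝ) < 0 by norm_num)).Dtmin - 2 * A) +
              msD A₃ A₄ 1 * Wφ) * msD A₃ A₄ 1 ^ 2 +
          K₂ * (radialRowOneConst A ((bandBounds (show (-4 : ℝ) < -1.1 by norm_num) (show (-1.1 : ℝ) ≤ -0.1 by norm_num) (show (-0.1 : ℝ) < 0 by norm_num)).Dtmin -
                2 * A) * hi + msD A₃ A₄ 2 * Wφ) * (msD A₃ A₄ 1 + msD A₃ A₄ 1) +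
          K₂ * (τ₀ + msD A₃ A₄ 1 * (ℓ) +
              hi / ((bandBounds (show (-4 : ℝ) < -1.1 by norm_num) (show (-1.1 : ℝ) ≤ -0.1 by norm_num) (show (-0.1 : ℝ) < 0 by norm_num)).Dtmin - 2 * A) +
              msD A₃ A₄ 1 * Wφ) * msD A₃ A₄ 2 +
          K₁ * ((uRowTwoConst A A₃ ((bandBounds (show (-4 : ℝ) < -1.1 by norm_num) (show (-1.1 : ℝ) ≤ -0.1 by norm_num) (show (-0.1 : ℝ) < 0 by norm_num)).Dtmin -
                  2 * A) +
                1 / ((bandBounds (show (-4 : ℝ) < -1.1 by norm_num) (show (-1.1 : ℝ) ≤ -0.1 by norm_num) (show (-0.1 : ℝ) < 0 by norm_num)).Dtmin - 2 * A) +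
                2 * (radialRowOneConst A ((bandBounds (show (-4 : ℝ) < -1.1 by norm_num) (show (-1.1 : ℝ) ≤ -0.1 by norm_num)
                    (show (-0.1 : ℝ) < 0 by norm_num)).Dtmin - 2 * A) -
                  1 / ((bandBounds (show (-4 : ℝ) < -1.1 by norm_num) (show (-1.1 : ℝ) ≤ -0.1 by norm_num) (show (-0.1 : ℝ) < 0 by norm_num)).Dtmin - 2 * A))) *
              hi + msD A₃ A₄ 3 * Wφ) ≤
        w * (bandBounds (show (-4 : ℝ) < -1.1 by norm_num) (show (-1.1 : ℝ) ≤ -0.1 by norm_num) (show (-0.1 : ℝ) < 0 by norm_num)).umin ^ 2)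
    (hsl : K₂ * msD A₃ A₄ 1 * (τ₀ + msD A₃ A₄ 1 * (ℓ) +
        2 * (hi / ((bandBounds (show (-4 : ℝ) < -1.1 by norm_num) (show (-1.1 : ℝ) ≤ -0.1 by norm_num) (show (-0.1 : ℝ) < 0 by norm_num)).Dtmin - 2 * A))) ≤
      w * (bandBounds (show (-4 : ℝ) < -1.1 by norm_num) (show (-1.1 : ℝ) ≤ -0.1 by norm_num) (show (-0.1 : ℝ) < 0 by norm_num)).umin ^ 2 * Wm)
    (hrt : K₂ * (τ₀ + msD A₃ A₄ 1 * (ℓ) +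
          2 * (hi / ((bandBounds (show (-4 : ℝ) < -1.1 by norm_num) (show (-1.1 : ℝ) ≤ -0.1 by norm_num) (show (-0.1 : ℝ) < 0 by norm_num)).Dtmin - 2 * A) +
            msD A₃ A₄ 1 * Wφ)) /
        ((bandBounds (show (-4 : ℝ) < -1.1 by norm_num) (show (-1.1 : ℝ) ≤ -0.1 by norm_num) (show (-0.1 : ℝ) < 0 by norm_num)).Dtmin - 2 * A) ≤ 1 / 2)
    (hlo0 : 0 < lo) (hlohi : lo ≤ hi) (hhir : hi < r) (hqs : 3 / 2 ≤ qs) (hX₀ : 0 ≤ X₀) (hX₁ : 0 ≤ X₁) (hXL : 0 ≤ XL) (hW : 0 ≤ W) (hAfl : 0 ≤ Afl) (hBfl : 0 ≤ Bfl)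
    (hK₀ : ∀ p : Momentum, |frameLevel μ K p| ≤ K₀) (hK₀pos : 0 < K₀) (hΓ₁ : K₀ ≤ Γ) (hΓ₂ : hi / 2 ≤ Γ) (hΓ'₁ : K₀ ≤ Γ')
    (hΓ'₂ : w * (bandBounds (show (-4 : ℝ) < -1.1 by norm_num) (show (-1.1 : ℝ) ≤ -0.1 by norm_num) (show (-0.1 : ℝ) < 0 by norm_num)).umin ^ 2 / 2 * (φb - φa + 2 * Wm) ^ 2 ≤ Γ')
    (hΔ : τ₀ + msD A₃ A₄ 1 * (ℓ) + 2 * (msD A₃ A₄ 1 * Wφ) ≤ Δ) (hΔ1 : Δ ≤ 3 / 10) (hΔu : Δ ≤ (bandBounds (show (-4 : ℝ) < -1.1 by norm_num) (show (-1.1 : ℝ) ≤ -0.1 by norm_num) (show (-0.1 : ℝ) < 0 by norm_num)).umin) (hΔr : K₁ * Δ < r) (hDfl : K₁ * Δ ≤ Dfl)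
    (hKd : ∀ e ∈ Icc (-hi) hi, ContDiff ℝ 1 (Kr e)) (hK2d : ∀ e ∈ Icc lo hi, ContDiff ℝ 2 (Kr e))
    (hK0 : ∀ e ∈ Icc (-hi) hi, e ≠ 0 → ∀ u, |Kr e u| ≤ (max |e| |u|)⁻¹) (hK0s : ∀ e ∈ Icc (-lo) lo, ∀ u, |Kr e u| ≤ (max lo |u|)⁻¹)
    (hK1 : ∀ e ∈ Icc (-hi) hi, e ≠ 0 → ∀ u, |deriv (Kr e) u| ≤ (max |e| |u|)⁻¹ ^ 2)
    (hK2 : ∀ e ∈ Icc lo hi, ∀ u, |iteratedDeriv 2 (Kr e) u| ≤ (max e |u|)⁻¹ ^ 3)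
    (hsupp : ∀ e ∈ Icc lo hi, ∀ u, |u| ≤ qs * e → deriv (Kr e) u = 0) (hKc : Continuous fun p : ℝ × ℝ => deriv (Kr p.1) p.2)
    (hflat : ∀ D : ℝ, 0 < D → D ≤ Dfl → |∫ e in lo..hi, wt e * deriv (Kr e) (D - e)| ≤ Afl * (lo / (max D lo) ^ 2) + Bfl)
    (hKn1 : ∀ s ∈ Icc lo hi, ∀ u, s / 2 ≤ u → |deriv (Kr (-s)) u| ≤ ρm s * ((max (u - s) lo)⁻¹ ^ 2))
    (hρ0 : ∀ s ∈ Icc lo hi, 0 ≤ ρm s) (hρc : ContinuousOn ρm (Icc lo hi))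
    (hρtail : ∀ a ∈ Icc lo hi, ∫ s in a..hi, ρm s ≤ Mρ * (lo * (lo / a) ^ 2))
    (hKs1 : ∀ e ∈ Icc (-lo) lo, ∀ u, |deriv (Kr e) u| ≤ (max lo |u|)⁻¹ ^ 2)
    (hXd : ∀ e ∈ Icc (-hi) hi, ContDiff ℝ 1 (X e)) (hX2 : ContinuousOn (fun p : ℝ × ℝ => X p.1 p.2) (Icc (-hi) hi ×ˢ univ))
    (hXs : ∀ e ∈ Icc (-hi) hi, tsupport (X e) ⊆ Ioo φa φb)
    (hXb : ∀ e ∈ Icc (-hi) hi, ∀ v, |X e v| ≤ X₀) (hX₁b : ∀ e ∈ Icc (-hi) hi, ∀ v, |deriv (X e) v| ≤ X₁)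
    (hXLip : ∀ e ∈ Icc lo hi, ∀ v, |X e v - X lo v| ≤ XL * |e - lo|)
    (hwc : ContinuousOn wt (Icc (-hi) hi)) (hw0 : ∀ e ∈ Icc (-hi) hi, 0 ≤ wt e) (hwW : ∀ e ∈ Icc (-hi) hi, wt e ≤ W)
    (hsame : τ₀ + 2 * (msD A₃ A₄ 1 * η₀ + |ρ| / ((bandBounds (show (-4 : ℝ) < -1.1 by norm_num) (show (-1.1 : ℝ) ≤ -0.1 by norm_num) (show (-0.1 : ℝ) < 0 by norm_num)).Dtmin - 2 * A)) ≤ 3 / 5)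
    (hΔc : τ₀ + msD A₃ A₄ 1 * ((ℓ) + (φb - φa + 2 * Wm)) ≤ Δc) (hΔc1 : Δc ≤ 3 / 10) (hΔcr : K₁ * Δc < r) (hω₁ : η₀ + (ℓ) ≤ ω) (hω₂ : φb - φa + 2 * Wm ≤ ω)
    (hκ : 0 < 2 / π * (((bandBounds (show (-4 : ℝ) < -1.1 by norm_num) (show (-1.1 : ℝ) ≤ -0.1 by norm_num) (show (-0.1 : ℝ) < 0 by norm_num)).Dtmin - 2 * A) * (bandBounds (show (-4 : ℝ) < -1.1 by norm_num) (show (-1.1 : ℝ) ≤ -0.1 by norm_num) (show (-0.1 : ℝ) < 0 by norm_num)).umin) *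
      ((bandBounds (show (-4 : ℝ) < -1.1 by norm_num) (show (-1.1 : ℝ) ≤ -0.1 by norm_num) (show (-0.1 : ℝ) < 0 by norm_num)).umin * (3 / 200) / (4 + 2 * A) * (η₀ - (ℓ) - π / (2 * (bandBounds (show (-4 : ℝ) < -1.1 by norm_num) (show (-1.1 : ℝ) ≤ -0.1 by norm_num) (show (-0.1 : ℝ) < 0 by norm_num)).umin) * Δc) - π * 7 * (K₁ * Δc + |ρ|) / ((bandBounds (show (-4 : ℝ) < -1.1 by norm_num) (show (-1.1 : ℝ) ≤ -0.1 by norm_num) (show (-0.1 : ℝ) < 0 by norm_num)).Dtmin - 2 * A) ^ 2))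
    (hΓ : 2 / π * (((bandBounds (show (-4 : ℝ) < -1.1 by norm_num) (show (-1.1 : ℝ) ≤ -0.1 by norm_num) (show (-0.1 : ℝ) < 0 by norm_num)).Dtmin - 2 * A) * (bandBounds (show (-4 : ℝ) < -1.1 by norm_num) (show (-1.1 : ℝ) ≤ -0.1 by norm_num) (show (-0.1 : ℝ) < 0 by norm_num)).umin) *
      ((bandBounds (show (-4 : ℝ) < -1.1 by norm_num) (show (-1.1 : ℝ) ≤ -0.1 by norm_num) (show (-0.1 : ℝ) < 0 by norm_num)).umin * (3 / 200) / (4 + 2 * A) * (η₀ - (ℓ) - π / (2 * (bandBounds (show (-4 : ℝ) < -1.1 by norm_num) (show (-1.1 : ℝ) ≤ -0.1 by norm_num) (show (-0.1 : ℝ) < 0 by norm_num)).umin) * Δc) - π * 7 * (K₁ * Δc + |ρ|) / ((bandBounds (show (-4 : ℝ) < -1.1 by norm_num) (show (-1.1 : ℝ) ≤ -0.1 by norm_num) (show (-0.1 : ℝ) < 0 by norm_num)).Dtmin - 2 * A) ^ 2) * (ℓ) ≤ Γ)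
    (hbudget : 2 * (2 * K₃ * Δc * msD A₃ A₄ 1 ^ 2 +
        4 * K₂ * (radialRowOneConst A ((bandBounds (show (-4 : ℝ) < -1.1 by norm_num) (show (-1.1 : ℝ) ≤ -0.1 by norm_num) (show (-0.1 : ℝ) < 0 by norm_num)).Dtmin - 2 * A) * |ρ| + msD A₃ A₄ 2 * ω) * msD A₃ A₄ 1 +
        K₂ * Δc * msD A₃ A₄ 2 +
        K₁ * ((uRowTwoConst A A₃ ((bandBounds (show (-4 : ℝ) < -1.1 by norm_num) (show (-1.1 : ℝ) ≤ -0.1 by norm_num) (show (-0.1 : ℝ) < 0 by norm_num)).Dtmin - 2 * A) + 1 / ((bandBounds (show (-4 : ℝ) < -1.1 by norm_num) (show (-1.1 : ℝ) ≤ -0.1 by norm_num) (show (-0.1 : ℝ) < 0 by norm_num)).Dtmin - 2 * A) +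
              2 * (radialRowOneConst A ((bandBounds (show (-4 : ℝ) < -1.1 by norm_num) (show (-1.1 : ℝ) ≤ -0.1 by norm_num) (show (-0.1 : ℝ) < 0 by norm_num)).Dtmin - 2 * A) - 1 / ((bandBounds (show (-4 : ℝ) < -1.1 by norm_num) (show (-1.1 : ℝ) ≤ -0.1 by norm_num) (show (-0.1 : ℝ) < 0 by norm_num)).Dtmin - 2 * A))) * |ρ| + msD A₃ A₄ 3 * ω)) < 9 / 400 * (bandBounds (show (-4 : ℝ) < -1.1 by norm_num) (show (-1.1 : ℝ) ≤ -0.1 by norm_num) (show (-0.1 : ℝ) < 0 by norm_num)).umin ^ 2)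
    (hhir₀ : hi < r₀) (hhiK : hi ≤ K₀) (hd₁ : 0 < d₁) (hlam : 0 < lam)
    (hhid : K₁ * (hi / ((bandBounds (show (-4 : ℝ) < -1.1 by norm_num) (show (-1.1 : ℝ) ≤ -0.1 by norm_num) (show (-0.1 : ℝ) < 0 by norm_num)).Dtmin - 2 * A)) ≤ d₁ / 2)
    (heps : d₁ + K₁ * (msD A₃ A₄ 1 * (φb - φa)) + K₁ * (hi / ((bandBounds (show (-4 : ℝ) < -1.1 by norm_num) (show (-1.1 : ℝ) ≤ -0.1 by norm_num) (show (-0.1 : ℝ) < 0 by norm_num)).Dtmin - 2 * A)) + hi ≤ eps) (hepsr : eps ≤ r)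
    (hC : ∀ ϑ ∈ Icc α₀ (α₀ + Nt * ℓ), ∀ m : Fin 2 → ℤ, msD A₃ A₄ 1 *
            ((π / 2 * lam /
                  (((bandBounds (show (-4 : ℝ) < -1.1 by norm_num) (show (-1.1 : ℝ) ≤ -0.1 by norm_num) (show (-0.1 : ℝ) < 0 by norm_num)).Dtmin -
                      2 * A) *
                    (bandBounds (show (-4 : ℝ) < -1.1 by norm_num) (show (-1.1 : ℝ) ≤ -0.1 by norm_num) (show (-0.1 : ℝ) < 0 by norm_num)).umin) +
                π * Kc * eps / ((bandBounds (show (-4 : ℝ) < -1.1 by norm_num) (show (-1.1 : ℝ) ≤ -0.1 by norm_num) (show (-0.1 : ℝ) < 0 by norm_num)).Dtmin - 2 * A) ^ 2) /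
              ((bandBounds (show (-4 : ℝ) < -1.1 by norm_num) (show (-1.1 : ℝ) ≤ -0.1 by norm_num) (show (-0.1 : ℝ) < 0 by norm_num)).umin * w /
                (4 + 2 * A))) +
          eps / ((bandBounds (show (-4 : ℝ) < -1.1 by norm_num) (show (-1.1 : ℝ) ≤ -0.1 by norm_num) (show (-0.1 : ℝ) < 0 by norm_num)).Dtmin - 2 * A) <
        ‖pairSumPath μ K ρ ϑ θ 0 - WithLp.toLp 2 (fun i => 2 * π * (m i : ℝ))‖)
    (hτ₀ : msD A₃ A₄ 1 *
            ((π / 2 * lam /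
                  (((bandBounds (show (-4 : ℝ) < -1.1 by norm_num) (show (-1.1 : ℝ) ≤ -0.1 by norm_num) (show (-0.1 : ℝ) < 0 by norm_num)).Dtmin -
                      2 * A) *
                    (bandBounds (show (-4 : ℝ) < -1.1 by norm_num) (show (-1.1 : ℝ) ≤ -0.1 by norm_num) (show (-0.1 : ℝ) < 0 by norm_num)).umin) +
                π * Kc * eps / ((bandBounds (show (-4 : ℝ) < -1.1 by norm_num) (show (-1.1 : ℝ) ≤ -0.1 by norm_num) (show (-0.1 : ℝ) < 0 by norm_num)).Dtmin - 2 * A) ^ 2) /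
              ((bandBounds (show (-4 : ℝ) < -1.1 by norm_num) (show (-1.1 : ℝ) ≤ -0.1 by norm_num) (show (-0.1 : ℝ) < 0 by norm_num)).umin * w /
                (4 + 2 * A))) +
          (2 * hi + eps) / ((bandBounds (show (-4 : ℝ) < -1.1 by norm_num) (show (-1.1 : ℝ) ≤ -0.1 by norm_num) (show (-0.1 : ℝ) < 0 by norm_num)).Dtmin -
            2 * A) ≤ τ₀)
    (harc : ∀ ϑ ∈ Icc α₀ (α₀ + Nt * ℓ), 6 * π ^ 2 * (2 * A + |ρ| + Kc * τ₀ / 2) / (-μ - A - |ρ|) <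
      (2 * (bandBounds (show (-4 : ℝ) < -1.1 by norm_num) (show (-1.1 : ℝ) ≤ -0.1 by norm_num) (show (-0.1 : ℝ) < 0 by norm_num)).umin / π * torusDist ϑ) ^ 2) :
    ∫ ϑ in α₀..(α₀ + Nt * ℓ), |∫ e in (-hi)..hi, ∫ v in φa..φb, wt e * (X e v * deriv (Kr e) (frameLevel μ K (pairSumPath μ K ρ ϑ θ 0 - levelPoint μ K e (v + θ))))| ≤ (Nt : ℝ) * max (max (2 * ((2 * (      3 * W * ((4 + 2 * (3 / 2 : ℝ) + 1 / 2) / (1 / 2)) *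
          (X₀ * (4 / Real.sqrt (2 * (K₂ * msD A₃ A₄ 1 ^ 2) +
                    w * (bandBounds (show (-4 : ℝ) < -1.1 by norm_num) (show (-1.1 : ℝ) ≤ -0.1 by norm_num) (show (-0.1 : ℝ) < 0 by norm_num)).umin ^ 2) +
                  16 * Real.sqrt (2 * (K₂ * msD A₃ A₄ 1 ^ 2) +
                        w * (bandBounds (show (-4 : ℝ) < -1.1 by norm_num) (show (-1.1 : ℝ) ≤ -0.1 by norm_num) (show (-0.1 : ℝ) < 0 by norm_num)).umin ^ 2) /
                      (w * (bandBounds (show (-4 : ℝ) < -1.1 by norm_num) (show (-1.1 : ℝ) ≤ -0.1 by norm_num) (show (-0.1 : ℝ) < 0 by norm_num)).umin ^ 2) +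
                  64 * (2 * (K₂ * msD A₃ A₄ 1 ^ 2) +
                          w * (bandBounds (show (-4 : ℝ) < -1.1 by norm_num) (show (-1.1 : ℝ) ≤ -0.1 by norm_num) (show (-0.1 : ℝ) < 0 by norm_num)).umin ^ 2) ^ 2 *
                      Real.sqrt (2 * (K₂ * msD A₃ A₄ 1 ^ 2) +
                          w * (bandBounds (show (-4 : ℝ) < -1.1 by norm_num) (show (-1.1 : ℝ) ≤ -0.1 by norm_num) (show (-0.1 : ℝ) < 0 by norm_num)).umin ^ 2) /
                    (w * (bandBounds (show (-4 : ℝ) < -1.1 by norm_num) (show (-1.1 : ℝ) ≤ -0.1 by norm_num) (show (-0.1 : ℝ) < 0 by norm_num)).umin ^ 2) ^ 3) *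
              Real.sqrt (4 + 2 * (3 / 2 : ℝ) + 1 / 2) +
            32 * X₁ * (2 * (K₂ * msD A₃ A₄ 1 ^ 2) +
                  w * (bandBounds (show (-4 : ℝ) < -1.1 by norm_num) (show (-1.1 : ℝ) ≤ -0.1 by norm_num) (show (-0.1 : ℝ) < 0 by norm_num)).umin ^ 2) /
              (w * (bandBounds (show (-4 : ℝ) < -1.1 by norm_num) (show (-1.1 : ℝ) ≤ -0.1 by norm_num) (show (-0.1 : ℝ) < 0 by norm_num)).umin ^ 2) ^ 2))) * max 1 (Real.sqrt (2 / π * (((bandBounds (show (-4 : ℝ) < -1.1 by norm_num) (show (-1.1 : ℝ) ≤ -0.1 by norm_num) (show (-0.1 : ℝ) < 0 by norm_num)).Dtmin - 2 * A) * (bandBounds (show (-4 : ℝ) < -1.1 by norm_num) (show (-1.1 : ℝ) ≤ -0.1 by norm_num) (show (-0.1 : ℝ) < 0 by norm_num)).umin) *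
      ((bandBounds (show (-4 : ℝ) < -1.1 by norm_num) (show (-1.1 : ℝ) ≤ -0.1 by norm_num) (show (-0.1 : ℝ) < 0 by norm_num)).umin * (3 / 200) / (4 + 2 * A) * (η₀ - (ℓ) - π / (2 * (bandBounds (show (-4 : ℝ) < -1.1 by norm_num) (show (-1.1 : ℝ) ≤ -0.1 by norm_num) (show (-0.1 : ℝ) < 0 by norm_num)).umin) * Δc) - π * 7 * (K₁ * Δc + |ρ|) / ((bandBounds (show (-4 : ℝ) < -1.1 by norm_num) (show (-1.1 : ℝ) ≤ -0.1 by norm_num) (show (-0.1 : ℝ) < 0 by norm_num)).Dtmin - 2 * A) ^ 2)))⁻¹ * (81 * (Γ / (2 / π * (((bandBounds (show (-4 : ℝ) < -1.1 by norm_num) (show (-1.1 : ℝ) ≤ -0.1 by norm_num) (show (-0.1 : ℝ) < 0 by norm_num)).Dtmin - 2 * A) * (bandBounds (show (-4 : ℝ) < -1.1 by norm_num) (show (-1.1 : ℝ) ≤ -0.1 by norm_num) (show (-0.1 : ℝ) < 0 by norm_num)).umin) *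
      ((bandBounds (show (-4 : ℝ) < -1.1 by norm_num) (show (-1.1 : ℝ) ≤ -0.1 by norm_num) (show (-0.1 : ℝ) < 0 by norm_num)).umin * (3 / 200) / (4 + 2 * A) * (η₀ - (ℓ) - π / (2 * (bandBounds (show (-4 : ℝ) < -1.1 by norm_num) (show (-1.1 : ℝ) ≤ -0.1 by norm_num) (show (-0.1 : ℝ) < 0 by norm_num)).umin) * Δc) - π * 7 * (K₁ * Δc + |ρ|) / ((bandBounds (show (-4 : ℝ) < -1.1 by norm_num) (show (-1.1 : ℝ) ≤ -0.1 by norm_num) (show (-0.1 : ℝ) < 0 by norm_num)).Dtmin - 2 * A) ^ 2))) ^ (1 / 4 : ℝ)) *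
          ((ℓ) ^ (3 / 4 : ℝ) / (3 / 4) + (ℓ) ^ (1 / 4 : ℝ) / (1 / 4))))
      ((8 * (32 * (X₀ * Afl + 5 * (W * X₀ * Mρ) + 32 * (W * X₀)) / (3 * Real.sqrt (w * (bandBounds (show (-4 : ℝ) < -1.1 by norm_num) (show (-1.1 : ℝ) ≤ -0.1 by norm_num) (show (-0.1 : ℝ) < 0 by norm_num)).umin ^ 2 / 2))) + 4 * (2 * (      W * (X₀ * (4 / Real.sqrt (2 * (K₂ * msD A₃ A₄ 1 ^ 2) +
                    w * (bandBounds (show (-4 : ℝ) < -1.1 by norm_num) (show (-1.1 : ℝ) ≤ -0.1 by norm_num) (show (-0.1 : ℝ) < 0 by norm_num)).umin ^ 2) + 16 * Real.sqrt (2 * (K₂ * msD A₃ A₄ 1 ^ 2) +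
                    w * (bandBounds (show (-4 : ℝ) < -1.1 by norm_num) (show (-1.1 : ℝ) ≤ -0.1 by norm_num) (show (-0.1 : ℝ) < 0 by norm_num)).umin ^ 2) / (w * (bandBounds (show (-4 : ℝ) < -1.1 by norm_num) (show (-1.1 : ℝ) ≤ -0.1 by norm_num) (show (-0.1 : ℝ) < 0 by norm_num)).umin ^ 2) + 64 * (2 * (K₂ * msD A₃ A₄ 1 ^ 2) +
                    w * (bandBounds (show (-4 : ℝ) < -1.1 by norm_num) (show (-1.1 : ℝ) ≤ -0.1 by norm_num) (show (-0.1 : ℝ) < 0 by norm_num)).umin ^ 2) ^ 2 * Real.sqrt (2 * (K₂ * msD A₃ A₄ 1 ^ 2) +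
                    w * (bandBounds (show (-4 : ℝ) < -1.1 by norm_num) (show (-1.1 : ℝ) ≤ -0.1 by norm_num) (show (-0.1 : ℝ) < 0 by norm_num)).umin ^ 2) / (w * (bandBounds (show (-4 : ℝ) < -1.1 by norm_num) (show (-1.1 : ℝ) ≤ -0.1 by norm_num) (show (-0.1 : ℝ) < 0 by norm_num)).umin ^ 2) ^ 3 +
              2 * Real.sqrt (w * (bandBounds (show (-4 : ℝ) < -1.1 by norm_num) (show (-1.1 : ℝ) ≤ -0.1 by norm_num) (show (-0.1 : ℝ) < 0 by norm_num)).umin ^ 2) / (w * (bandBounds (show (-4 : ℝ) < -1.1 by norm_num) (show (-1.1 : ℝ) ≤ -0.1 by norm_num) (show (-0.1 : ℝ) < 0 by norm_num)).umin ^ 2) + (2 * (K₂ * msD A₃ A₄ 1 ^ 2) +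
                    w * (bandBounds (show (-4 : ℝ) < -1.1 by norm_num) (show (-1.1 : ℝ) ≤ -0.1 by norm_num) (show (-0.1 : ℝ) < 0 by norm_num)).umin ^ 2) * Real.sqrt (w * (bandBounds (show (-4 : ℝ) < -1.1 by norm_num) (show (-1.1 : ℝ) ≤ -0.1 by norm_num) (show (-0.1 : ℝ) < 0 by norm_num)).umin ^ 2) / (w * (bandBounds (show (-4 : ℝ) < -1.1 by norm_num) (show (-1.1 : ℝ) ≤ -0.1 by norm_num) (show (-0.1 : ℝ) < 0 by norm_num)).umin ^ 2) ^ 2) +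
            X₁ * (32 * (2 * (K₂ * msD A₃ A₄ 1 ^ 2) +
                    w * (bandBounds (show (-4 : ℝ) < -1.1 by norm_num) (show (-1.1 : ℝ) ≤ -0.1 by norm_num) (show (-0.1 : ℝ) < 0 by norm_num)).umin ^ 2) * Real.sqrt (K₀ + hi) / (w * (bandBounds (show (-4 : ℝ) < -1.1 by norm_num) (show (-1.1 : ℝ) ≤ -0.1 by norm_num) (show (-0.1 : ℝ) < 0 by norm_num)).umin ^ 2) ^ 2 + (φb - φa + 2 * Wm) * Real.sqrt (w * (bandBounds (show (-4 : ℝ) < -1.1 by norm_num) (show (-1.1 : ℝ) ≤ -0.1 by norm_num) (show (-0.1 : ℝ) < 0 by norm_num)).umin ^ 2) / (w * (bandBounds (show (-4 : ℝ) < -1.1 by norm_num) (show (-1.1 : ℝ) ≤ -0.1 by norm_num) (show (-0.1 : ℝ) < 0 by norm_num)).umin ^ 2))) *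
          ((4 + 2 * (3 / 2 : ℝ) + 1 / 2) * Real.sqrt (4 + 2 * (3 / 2 : ℝ) + 1 / 2) *
                ((1 + Real.log 2 + log⁺ ((1 + 4 * (2 * (K₂ * msD A₃ A₄ 1 ^ 2) +
                    w * (bandBounds (show (-4 : ℝ) < -1.1 by norm_num) (show (-1.1 : ℝ) ≤ -0.1 by norm_num) (show (-0.1 : ℝ) < 0 by norm_num)).umin ^ 2) / (w * (bandBounds (show (-4 : ℝ) < -1.1 by norm_num) (show (-1.1 : ℝ) ≤ -0.1 by norm_num) (show (-0.1 : ℝ) < 0 by norm_num)).umin ^ 2)) * (1 + (3 / 2 : ℝ))) + log⁺ (1 + 4 * (2 * (K₂ * msD A₃ A₄ 1 ^ 2) +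
                    w * (bandBounds (show (-4 : ℝ) < -1.1 by norm_num) (show (-1.1 : ℝ) ≤ -0.1 by norm_num) (show (-0.1 : ℝ) < 0 by norm_num)).umin ^ 2) / (w * (bandBounds (show (-4 : ℝ) < -1.1 by norm_num) (show (-1.1 : ℝ) ≤ -0.1 by norm_num) (show (-0.1 : ℝ) < 0 by norm_num)).umin ^ 2))) + 4) +
            2 * (1 + Real.log 2 + log⁺ ((1 + 4 * (2 * (K₂ * msD A₃ A₄ 1 ^ 2) +
                    w * (bandBounds (show (-4 : ℝ) < -1.1 by norm_num) (show (-1.1 : ℝ) ≤ -0.1 by norm_num) (show (-0.1 : ℝ) < 0 by norm_num)).umin ^ 2) / (w * (bandBounds (show (-4 : ℝ) < -1.1 by norm_num) (show (-1.1 : ℝ) ≤ -0.1 by norm_num) (show (-0.1 : ℝ) < 0 by norm_num)).umin ^ 2)) * (1 + (3 / 2 : ℝ))) + log⁺ (1 + 4 * (2 * (K₂ * msD A₃ A₄ 1 ^ 2) +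
                    w * (bandBounds (show (-4 : ℝ) < -1.1 by norm_num) (show (-1.1 : ℝ) ≤ -0.1 by norm_num) (show (-0.1 : ℝ) < 0 by norm_num)).umin ^ 2) / (w * (bandBounds (show (-4 : ℝ) < -1.1 by norm_num) (show (-1.1 : ℝ) ≤ -0.1 by norm_num) (show (-0.1 : ℝ) < 0 by norm_num)).umin ^ 2))) *
              ((4 + 2 * (3 / 2 : ℝ) + 1 / 2) / (1 / 2) * Real.sqrt ((4 + 2 * (3 / 2 : ℝ) + 1 / 2) / (1 / 2))))))) / Real.sqrt ((9 / 400 * (bandBounds (show (-4 : ℝ) < -1.1 by norm_num) (show (-1.1 : ℝ) ≤ -0.1 by norm_num) (show (-0.1 : ℝ) < 0 by norm_num)).umin ^ 2 - 2 * (2 * K₃ * Δc * msD A₃ A₄ 1 ^ 2 +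
        4 * K₂ * (radialRowOneConst A ((bandBounds (show (-4 : ℝ) < -1.1 by norm_num) (show (-1.1 : ℝ) ≤ -0.1 by norm_num) (show (-0.1 : ℝ) < 0 by norm_num)).Dtmin - 2 * A) * |ρ| + msD A₃ A₄ 2 * ω) * msD A₃ A₄ 1 +
        K₂ * Δc * msD A₃ A₄ 2 +
        K₁ * ((uRowTwoConst A A₃ ((bandBounds (show (-4 : ℝ) < -1.1 by norm_num) (show (-1.1 : ℝ) ≤ -0.1 by norm_num) (show (-0.1 : ℝ) < 0 by norm_num)).Dtmin - 2 * A) + 1 / ((bandBounds (show (-4 : ℝ) < -1.1 by norm_num) (show (-1.1 : ℝ) ≤ -0.1 by norm_num) (show (-0.1 : ℝ) < 0 by norm_num)).Dtmin - 2 * A) +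
              2 * (radialRowOneConst A ((bandBounds (show (-4 : ℝ) < -1.1 by norm_num) (show (-1.1 : ℝ) ≤ -0.1 by norm_num) (show (-0.1 : ℝ) < 0 by norm_num)).Dtmin - 2 * A) - 1 / ((bandBounds (show (-4 : ℝ) < -1.1 by norm_num) (show (-1.1 : ℝ) ≤ -0.1 by norm_num) (show (-0.1 : ℝ) < 0 by norm_num)).Dtmin - 2 * A))) * |ρ| + msD A₃ A₄ 3 * ω))) / 2) + (((64 * W * (1 / (qs + 1 / 2)) ^ 2 * X₀ *
                (K₂ / ((bandBounds (show (-4 : ℝ) < -1.1 by norm_num) (show (-1.1 : ℝ) ≤ -0.1 by norm_num) (show (-0.1 : ℝ) < 0 by norm_num)).Dtmin - 2 * A)) *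
              ((1 / ((bandBounds (show (-4 : ℝ) < -1.1 by norm_num) (show (-1.1 : ℝ) ≤ -0.1 by norm_num) (show (-0.1 : ℝ) < 0 by norm_num)).Dtmin - 2 * A) +
                  msD A₃ A₄ 1 * (π * (4 + 2 * A) * Kc /
                    ((bandBounds (show (-4 : ℝ) < -1.1 by norm_num) (show (-1.1 : ℝ) ≤ -0.1 by norm_num) (show (-0.1 : ℝ) < 0 by norm_num)).umin * w *
                      ((bandBounds (show (-4 : ℝ) < -1.1 by norm_num) (show (-1.1 : ℝ) ≤ -0.1 by norm_num) (show (-0.1 : ℝ) < 0 by norm_num)).Dtmin - 2 * A) ^ 2))) +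
                2 * (1 / (qs + 1 / 2)) /
                  ((bandBounds (show (-4 : ℝ) < -1.1 by norm_num) (show (-1.1 : ℝ) ≤ -0.1 by norm_num) (show (-0.1 : ℝ) < 0 by norm_num)).Dtmin - 2 * A)) +
            4 * W * (1 / (qs + 1 / 2)) ^ 2 * XL + X₀ * Bfl) * (φb - φa + 2 * Wm) +
          8 * (128 * W * (1 / (qs + 1 / 2)) ^ 2 * X₀ *
                (K₂ / ((bandBounds (show (-4 : ℝ) < -1.1 by norm_num) (show (-1.1 : ℝ) ≤ -0.1 by norm_num) (show (-0.1 : ℝ) < 0 by norm_num)).Dtmin - 2 * A)) *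
              msD A₃ A₄ 1) /
            (w * (bandBounds (show (-4 : ℝ) < -1.1 by norm_num) (show (-1.1 : ℝ) ≤ -0.1 by norm_num) (show (-0.1 : ℝ) < 0 by norm_num)).umin ^ 2 / 2) * Real.log 2)) * (ℓ) +
        (4 * (128 * W * (1 / (qs + 1 / 2)) ^ 2 * X₀ *
              (K₂ / ((bandBounds (show (-4 : ℝ) < -1.1 by norm_num) (show (-1.1 : ℝ) ≤ -0.1 by norm_num) (show (-0.1 : ℝ) < 0 by norm_num)).Dtmin - 2 * A)) *
            msD A₃ A₄ 1) /
          (w * (bandBounds (show (-4 : ℝ) < -1.1 by norm_num) (show (-1.1 : ℝ) ≤ -0.1 by norm_num) (show (-0.1 : ℝ) < 0 by norm_num)).umin ^ 2 / 2)) * (2 * (Γ' / ((9 / 400 * (bandBounds (show (-4 : ℝ) < -1.1 by norm_num) (show (-1.1 : ℝ) ≤ -0.1 by norm_num) (show (-0.1 : ℝ) < 0 by norm_num)).umin ^ 2 - 2 * (2 * K₃ * Δc * msD A₃ A₄ 1 ^ 2 +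
        4 * K₂ * (radialRowOneConst A ((bandBounds (show (-4 : ℝ) < -1.1 by norm_num) (show (-1.1 : ℝ) ≤ -0.1 by norm_num) (show (-0.1 : ℝ) < 0 by norm_num)).Dtmin - 2 * A) * |ρ| + msD A₃ A₄ 2 * ω) * msD A₃ A₄ 1 +
        K₂ * Δc * msD A₃ A₄ 2 +
        K₁ * ((uRowTwoConst A A₃ ((bandBounds (show (-4 : ℝ) < -1.1 by norm_num) (show (-1.1 : ℝ) ≤ -0.1 by norm_num) (show (-0.1 : ℝ) < 0 by norm_num)).Dtmin - 2 * A) + 1 / ((bandBounds (show (-4 : ℝ) < -1.1 by norm_num) (show (-1.1 : ℝ) ≤ -0.1 by norm_num) (show (-0.1 : ℝ) < 0 by norm_num)).Dtmin - 2 * A) +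
              2 * (radialRowOneConst A ((bandBounds (show (-4 : ℝ) < -1.1 by norm_num) (show (-1.1 : ℝ) ≤ -0.1 by norm_num) (show (-0.1 : ℝ) < 0 by norm_num)).Dtmin - 2 * A) - 1 / ((bandBounds (show (-4 : ℝ) < -1.1 by norm_num) (show (-1.1 : ℝ) ≤ -0.1 by norm_num) (show (-0.1 : ℝ) < 0 by norm_num)).Dtmin - 2 * A))) * |ρ| + msD A₃ A₄ 3 * ω))) / 2)) ^ (1 / 4 : ℝ)) * (8 * Real.sqrt (ℓ))))
      (ℓ * max (2 * hi * ((φb - φa) * (W * X₀ * (4 / d₁ ^ 2))))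
        (W * ((X₀ * ((K₂ * msD A₃ A₄ 1 ^ 2 + K₁ * msD A₃ A₄ 2) / lam ^ 2) + X₁ * lam⁻¹) * (lam⁻¹ * (4 * Real.sqrt K₀))) * (4 * Real.sqrt hi))) := by
  have hhi0 : 0 ≤ hi := hlo0.le.trans hlohi
  have hK₁0 : 0 ≤ K₁ := (norm_nonneg _).trans (hK₁ 0)
  have hK₂0 : 0 ≤ K₂ := (norm_nonneg _).trans (hK₂ 0)
  have hD2 : 0 ≤ msD A₃ A₄ 2 := (msD_two_pos A₃ A₄).le
  have hG₂ : 0 ≤ K₂ * msD A₃ A₄ 1 ^ 2 + K₁ * msD A₃ A₄ 2 := by positivity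
  have hupos : 0 < 2 * (bandBounds (show (-4 : ℝ) < -1.1 by norm_num) (show (-1.1 : ℝ) ≤ -0.1 by norm_num) (show (-0.1 : ℝ) < 0 by norm_num)).umin / π := by
    have := (bandBounds (show (-4 : ℝ) < -1.1 by norm_num) (show (-1.1 : ℝ) ≤ -0.1 by norm_num) (show (-0.1 : ℝ) < 0 by norm_num)).umin_pos
    positivity
  -- the curvature ceiling
  have hcurv : ∀ ϑ ∈ Icc α₀ (α₀ + Nt * ℓ), ∀ e ∈ Icc (-hi) hi, ∀ v ∈ Icc φa φb,
      |iteratedDeriv 2 (fun x : ℝ => frameLevel μ K (pairSumPath μ K ρ ϑ θ 0 - levelPoint μ K e (x + θ))) v| ≤ K₂ * msD A₃ A₄ 1 ^ 2 + K₁ * msD A₃ A₄ 2 :=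
    fun ϑ _ e he v _ => abs_iteratedDeriv_two_partnerBand_pp_angle_le hA hA20 hd hlo hhi hA₃ hA₄ hK₁ hK₂ (pairSumPath μ K ρ ϑ θ 0)
      (abs_lt.2 ⟨by linarith only [he.1, hhir], lt_of_le_of_lt he.2 hhir⟩) θ v
  -- no direct-sheet caustic on the arc
  have hT0 : ∀ ϑ ∈ Icc α₀ (α₀ + Nt * ℓ), ∀ v ∈ Icc φa φb, τ₀ < ‖pairSumPath μ K ρ ϑ θ 0 - (2 : ℝ) • levelPoint μ K 0 (v + θ)‖ := by
    intro ϑ hϑ v _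
    by_contra hle
    push Not at hle
    have h1 := norm_chord_sq_le_of_midpoint_near hA hr hlo hhi hG hρ hle
    have h2 := torusDist_le_norm_chord hA hlo hhi hρ ϑ θ
    have h3 : (2 * (bandBounds (show (-4 : ℝ) < -1.1 by norm_num) (show (-1.1 : ℝ) ≤ -0.1 by norm_num) (show (-0.1 : ℝ) < 0 by norm_num)).umin / π *
        torusDist ϑ) ^ 2 ≤ ‖levelPoint μ K 0 θ - levelPoint μ K ρ (ϑ + θ)‖ ^ 2 :=
      pow_le_pow_left₀ (mul_nonneg hupos.le (norm_nonneg _)) h2 2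
    linarith only [h1, h3, harc ϑ hϑ]
  exact zone_integral_le hA hA20 hd hr hlo hhi hA₃ hA₄ hK₁ hK₂ hK₃ hF hG hρ hρ₀ θ (α₀ := α₀) (ℓ := ℓ) (φa := φa) (φb := φb)
      (τ₀ := τ₀) (lo := lo) (hi := hi) (Wφ := Wφ) (Wm := Wm) (qs := qs) (Δ := Δ) (K₀ := K₀) (X₀ := X₀) (X₁ := X₁) (XL := XL) (W := W)
      (Afl := Afl) (Bfl := Bfl) (Dfl := Dfl) (Mρ := Mρ) (Γ := Γ) (Γ' := Γ') (η₀ := η₀) (Δc := Δc) (ω := ω) (d₁ := d₁) (lam := lam) (eps := eps)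
      (G₂ := (K₂ * msD A₃ A₄ 1 ^ 2 + K₁ * msD A₃ A₄ 2)) (Kr := Kr) (X := X) (wt := wt) (ρm := ρm)
      hℓ hφ hWm hMρ hWφ hmod hsl hrt hlo0 hlohi hhir hqs hX₀ hX₁ hXL hW hAfl hBfl hK₀ hK₀pos hΓ₁ hΓ₂ hΓ'₁ hΓ'₂ hΔ hΔ1 hΔu hΔr hDfl hKd hK2d hK0 hK0s hK1 hK2
      hsupp hKc hflat hKn1 hρ0 hρc hρtail hKs1 hXd hX2 hXs hXb hX₁b hXLip hwc hw0 hwW hsame hΔc hΔc1 hΔcr hω₁ hω₂ hκ hΓ hbudget hhir₀ hhiK hd₁ hlam hG₂ hhid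
      heps hepsr hC hcurv hτ₀ hT0

end Sizes

end Summit.HubbardSuperconductivity.HubbardSuperconductivity.Theorems.C4a

end
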